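import Summits.BirchSwinnertonDyer.Rank1Residual.X11b.AnticyclotomicInfinitePlaces
import Summits.BirchSwinnertonDyer.Rank1Residual.X11b.AnticyclotomicEulerCharLinks
import HarnessLib

/-!
# X11b, route R1 — COUNTING FORM of the control step: with `s` bijective,
# "`ord_p f_ac^Σ(0) = n`" ⟺ `#Sel_𝔭^Σ(K, E[p^∞]) = p^n · #H¹(Γ, Sel_𝔭^Σ(K_∞, E[p^∞]))`

HONEST FRAMING (cell `b2b-bsdres`, run/shared/lean/b2b/bsd-rank1-residual/, verbatim in every
file): the goal of the cell is to DELETE the COMBINATION-SHAPED residual classes of the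
Birch–Swinnerton-Dyer formula for ALL analytic-rank `≤ 1` elliptic curves over `ℚ` — "full BSD
formula for every rank `≤ 1` curve in class `C`" assembled STRICTLY from published theorems — so
that the rank-`≤ 1` remainder becomes exactly the CONSTRUCTION-SHAPED classes, which are TYPED
(missing-input `Prop`s), NOT attempted. This is not "finishing BSD". Sub-cell
`b2b-bsdres-multr1-p1` (X11b, route R1 = Castella 2018 Thm. A re-proved along the author's
erratum); a RESEARCH ROUTE; no claim beyond the stated class; X11b stays CONSTRUCTION-SHAPED;
nothing here changes a label; no named fact is minted (proved theorems only; no `sorry`).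

## Why this file

Gen 9 rewrote both tree-object inputs of route R1 — the open (IMC∘BDP)@𝟙 (`IMCWaldspurgerOnTreeAt`)
and the PUB-shaped (CTL) (`ControlOnTreeAt`, Cas18 Thm. 2.3) — as Euler-characteristic identities
`#Sel_𝔭(K_∞, E[p^∞])^γ = p^n · #Sel_𝔭(K_∞, E[p^∞])_γ` (`XAc.hasCharValuationAt_iff_card`). Gen 10
constructed the control map `s : Sel_𝔭^Σ(K, E[p^∞]) → Sel_𝔭^Σ(K_∞, E[p^∞])^γ` and proved it
BIJECTIVE on route R1 modulo the descent of the away conditions (`controlMap_bijective_of_away_descent`;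
injectivity from `Irr ∧ Ram`, the strict place from (iv), the lift from Lemma 3.2, the infinite
places from `K_w = ℂ`). This bookkeeping file substitutes the bijection into the Euler form: the left
side `#H⁰(Γ, Sel_𝔭^Σ(K_∞, E[p^∞]))` becomes the order of Castella's Selmer group OVER `K`,
`#Sel_𝔭^Σ(K, E[p^∞])` — JSW's route to Thm. 3.3.1 (arXiv:1512.06894 §3.3.6: "`#𝒪/f(0) = #Sel^Γ`"
computed from the Selmer group over `K`, with `Sel_Γ = 0`).

## What is proved

* `natCard_selmerAcBase_eq_of_bijective`, `finite_selmerAcBase_iff_of_bijective` — transport of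
  `Nat.card` / finiteness along a bijective `s`;
* **`XAc.hasCharValuationAt_iff_card_base`** — for `X_ac^Σ` finitely generated (finite `Σ`) and `s`
  bijective: "`ord_p f_ac^Σ(0) = n`" (`XAc.HasCharValuationAt … n`) ⟺ `Sel_𝔭^Σ(K, E[p^∞])` finite and
  `#Sel_𝔭^Σ(K, E[p^∞]) = p^n · #Sel_𝔭^Σ(K_∞, E[p^∞])_γ`;
* **`XAc.hasCharValuationAt_iff_card_base_of_away_descent`** (totally complex `K`, hypotheses of
  `controlMap_bijective_of_away_descent`) and the route-R1 form
  **`ChainLocus.hasCharValuationAt_iff_card_base`** (imaginary quadratic `K`, degree-one `𝔭`, `Σ = ∅`):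
  on route R1, modulo the away descent, `#ℤ_p/f_ac(0) = #Sel_𝔭(K, E[p^∞]) / #H¹(Γ, Sel_𝔭(K_∞, E[p^∞]))`
  — the typed inputs `R1ControlOnTreeAt` / `R1OpenInputOnTreeAt` are identities about the order of
  a Selmer group OVER `K` and one `H¹(Γ, ·)`.

What is NOT claimed: `Sel_γ = 0`; the value of `#Sel_𝔭(K, E[p^∞])` (JSW §3.3.5); the away descent.

References: [JetchevSkinnerWan2017] §3.3.5–3.3.6 (shape only); [GreenbergLNM1716] §4 Lemma 4.2
(p. 102); [Castella2018] Thm. 2.3, §5 (5.1) (arXiv:1704.06608 pp. 5, 12).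
-/

noncomputable section

open scoped Classical

open NumberField IsDedekindDomain Field
open Literature.NumberTheory.EllipticCurves Literature.NumberTheory.EllipticCurves.GreenbergSelmer
open Literature.NumberTheory.GaloisRepresentations

universe u

namespace Summit.BirchSwinnertonDyer.Rank1Residual.X11b.AcSelmer

section Count

variable {K : Type u} [Field K] [NumberField K] (W : WeierstrassCurve K) (p : ℕ) [Fact p.Prime]
  (κ : ZpExtension K p) (𝔭 : HeightOneSpectrum (𝓞 K)) (S : Set (HeightOneSpectrum (𝓞 K)))
  (γ : absoluteGaloisGroup K)

/-- **`#Sel_𝔭^Σ(K, E[p^∞]) = #Sel_𝔭^Σ(K_∞, E[p^∞])^γ`** when `s` is bijective (`Nat.card` along the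
bijection; both sides `0` when infinite). [folklore] -/
theorem natCard_selmerAcBase_eq_of_bijective (hbij : Function.Bijective (controlMap W p κ 𝔭 S γ)) :
    Nat.card (selmerAcBase W p 𝔭 S) =
      Nat.card (IwasawaDual.endInvariants (conjSelmerAc W p κ 𝔭 S γ - 1)) :=
  Nat.card_congr (Equiv.ofBijective _ hbij)

/-- `Sel_𝔭^Σ(K, E[p^∞])` is finite iff `Sel^γ` is, when `s` is bijective. [folklore] -/
theorem finite_selmerAcBase_iff_of_bijective (hbij : Function.Bijective (controlMap W p κ 𝔭 S γ)) :
    Finite (selmerAcBase W p 𝔭 S) ↔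
      Finite (IwasawaDual.endInvariants (conjSelmerAc W p κ 𝔭 S γ - 1)) :=
  ⟨fun _ ↦ Finite.of_equiv _ (Equiv.ofBijective _ hbij),
    fun _ ↦ Finite.of_equiv _ (Equiv.ofBijective _ hbij).symm⟩

variable [Fact (κ.IsTopGenerator γ)]

/-- **"`ord_p f_ac^Σ(0) = n`" ⟺ `#Sel_𝔭^Σ(K, E[p^∞]) = p^n · #Sel_𝔭^Σ(K_∞, E[p^∞])_γ`** (with
`Sel_𝔭^Σ(K, E[p^∞])` finite), for `X_ac^Σ` finitely generated and `s` bijective: gen 9's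
Euler-characteristic form `XAc.hasCharValuationAt_iff_card` with `#Sel^γ` replaced by the order of
Castella's Selmer group over `K`. [cite: GreenbergLNM1716, §4 Lemma 4.2 (p. 102)] [cite: JetchevSkinnerWan2017, §3.3 (proof of Thm. 3.3.1, §§3.3.5–3.3.6) (shape only)] -/
theorem XAc.hasCharValuationAt_iff_card_base [Module.Finite (IwasawaAlgebra p) (XAc W p κ 𝔭 S γ)]
    (hbij : Function.Bijective (controlMap W p κ 𝔭 S γ)) (n : ℕ) :
    XAc.HasCharValuationAt W p κ 𝔭 S γ n ↔
      ∃ _ : Finite (selmerAcBase W p 𝔭 S),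
        Nat.card (selmerAcBase W p 𝔭 S) =
          p ^ n * Nat.card (IwasawaDual.EndCoinvariants (conjSelmerAc W p κ 𝔭 S γ - 1)) := by
  rw [XAc.hasCharValuationAt_iff_card, natCard_selmerAcBase_eq_of_bijective W p κ 𝔭 S γ hbij]
  constructor
  · rintro ⟨hfin, h⟩
    exact ⟨(finite_selmerAcBase_iff_of_bijective W p κ 𝔭 S γ hbij).mpr hfin, h⟩
  · rintro ⟨hfin, h⟩
    exact ⟨(finite_selmerAcBase_iff_of_bijective W p κ 𝔭 S γ hbij).mp hfin, h⟩

end Count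

section TotallyComplex

variable {K : Type} [Field K] [NumberField K] (W : WeierstrassCurve K) [W.IsElliptic] (p : ℕ)
  [Fact p.Prime] (κ : ZpExtension K p) (𝔭 : HeightOneSpectrum (𝓞 K))
  (S : Set (HeightOneSpectrum (𝓞 K))) (γ : absoluteGaloisGroup K) [hγ : Fact (κ.IsTopGenerator γ)]

/-- **Counting form modulo away descent** (totally complex `K`, finite `Σ`): under
`H¹(K, E[p^∞]) ↪ H¹(K_∞, E[p^∞])`, `E(K̄)[p^∞]^{D_𝔭 ⊓ ker κ} = 0` and the away descent `hS`,
"`ord_p f_ac^Σ(0) = n`" ⟺ `Sel_𝔭^Σ(K, E[p^∞])` finite with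
`#Sel_𝔭^Σ(K, E[p^∞]) = p^n · #Sel_𝔭^Σ(K_∞, E[p^∞])_γ` (`controlMap_bijective_of_away_descent`,
`XAc.module_finite`). [cite: GreenbergLNM1716, §4 Lemma 4.2 (p. 102)] [cite: JetchevSkinnerWan2017, §3.3 (shape only)] -/
theorem XAc.hasCharValuationAt_iff_card_base_of_away_descent [IsTotallyComplex K] (hS : S.Finite)
    (hinj : Function.Injective (ResKernel.resSubgroup κ.kerSubgroup (W.geomPrimaryTorsion p)))
    (h0 : FixedPoints.addSubgroup ↥(decomp 𝔭 ⊓ κ.kerSubgroup) (W.geomPrimaryTorsion p) = ⊥)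
    (hS' : ∀ c : W.subgroupH1 p (⊤ : Subgroup (absoluteGaloisGroup K)),
      W.resOfLe p (le_top : κ.kerSubgroup ≤ ⊤) c ∈ selmerAc W p κ 𝔭 S →
        ∀ v : HeightOneSpectrum (𝓞 K), ((p : ℕ) : 𝓞 K) ∉ v.asIdeal → v ∉ S →
          c ∈ awayKer ⊤ (W.geomPrimaryTorsion p) v) (n : ℕ) :
    XAc.HasCharValuationAt W p κ 𝔭 S γ n ↔
      ∃ _ : Finite (selmerAcBase W p 𝔭 S),
        Nat.card (selmerAcBase W p 𝔭 S) =
          p ^ n * Nat.card (IwasawaDual.EndCoinvariants (conjSelmerAc W p κ 𝔭 S γ - 1)) := by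
  haveI := XAc.module_finite κ 𝔭 S γ hS (W := W)
  exact XAc.hasCharValuationAt_iff_card_base W p κ 𝔭 S γ
    (controlMap_bijective_of_away_descent W p κ 𝔭 S hγ.out hinj h0 hS') n

end TotallyComplex

end Summit.BirchSwinnertonDyer.Rank1Residual.X11b.AcSelmer

/-! ## Route R1 -/

namespace Summit.BirchSwinnertonDyer.Rank1Residual.X11b

section RouteR1

open AcSelmer Literature.NumberTheory.EllipticCurves.Rank1Residual

variable {W : WeierstrassCurve ℚ} [W.IsElliptic] [W.IsGloballyMinimal] {p : ℕ} [Fact p.Prime]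

/-- **Route R1, counting form of the control step (`Σ = ∅`).** On `ChainLocus`, for every imaginary
quadratic `K`, every degree-one `𝔭 ∣ p`, every `ℤ_p`-extension `κ` with topological generator `γ`,
MODULO the away descent `hS`: "`ord_p f_ac(0) = n`" for the constructed `X_ac(E[p^∞])` ⟺
`Sel_𝔭(K, E[p^∞])` is finite and `#Sel_𝔭(K, E[p^∞]) = p^n · #H¹(Γ, Sel_𝔭(K_∞, E[p^∞]))`. Hence, at
the data of `R1ControlOnTreeAt` / `R1OpenInputOnTreeAt` (`controlOnTreeAt_iff_card`,
`imcWaldspurgerOnTreeAt_iff_card`), both typed inputs are identities about `#Sel_𝔭(K, E[p^∞])` and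
`#H¹(Γ, Sel_𝔭(K_∞, E[p^∞]))` only. [cite: JetchevSkinnerWan2017, §3.3.6 (shape only)] [cite: Castella2018, Thm. 2.3 and §5 (5.1) (arXiv:1704.06608 pp. 5, 12)] [cite: GreenbergLNM1716, §4 Lemma 4.2 (p. 102)] -/
theorem ChainLocus.hasCharValuationAt_iff_card_base (h : ChainLocus W p)
    (K : Type) [Field K] [NumberField K] (hK : IsImaginaryQuadratic K) (κ : ZpExtension K p)
    (γ : absoluteGaloisGroup K) [hγ : Fact (κ.IsTopGenerator γ)] (𝔭 : HeightOneSpectrum (𝓞 K))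
    (h𝔭 : ((p : ℕ) : 𝓞 K) ∈ 𝔭.asIdeal) (he : 𝔭.asIdeal.ramificationIdx (𝓞 ℚ) = 1)
    (hf : 𝔭.asIdeal.inertiaDeg (𝓞 ℚ) = 1)
    (hS : ∀ c : (W.baseChange K).subgroupH1 p (⊤ : Subgroup (absoluteGaloisGroup K)),
      (W.baseChange K).resOfLe p (le_top : κ.kerSubgroup ≤ ⊤) c ∈ selmerAc (W.baseChange K) p κ 𝔭 ∅ →
        ∀ v : HeightOneSpectrum (𝓞 K), ((p : ℕ) : 𝓞 K) ∉ v.asIdeal → v ∉ (∅ : Set _) →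
          c ∈ awayKer ⊤ ((W.baseChange K).geomPrimaryTorsion p) v) (n : ℕ) :
    XAc.HasCharValuationAt (W.baseChange K) p κ 𝔭 ∅ γ n ↔
      ∃ _ : Finite (selmerAcBase (W.baseChange K) p 𝔭 ∅),
        Nat.card (selmerAcBase (W.baseChange K) p 𝔭 ∅) =
          p ^ n * Nat.card (IwasawaDual.EndCoinvariants
            (conjSelmerAc (W.baseChange K) p κ 𝔭 ∅ γ - 1)) := by
  haveI := module_finite_XAc_baseChange p κ 𝔭 γ (W := W)
  exact XAc.hasCharValuationAt_iff_card_base (W.baseChange K) p κ 𝔭 ∅ γ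
    (h.controlMap_bijective_of_away_descent K hK κ hγ.out 𝔭 h𝔭 he hf ∅ hS) n

end RouteR1

end Summit.BirchSwinnertonDyer.Rank1Residual.X11b

end
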